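import Summits.QuantumFields.YangMills.Theorems.FlatTubeReductionGaussProfileNumbersII
import Summits.QuantumFields.YangMills.Theorems.FlatTubeReductionExactDressingOfProfileNumbersSq
import Summits.QuantumFields.YangMills.Theorems.FlatTubeReductionRateBudgetR
import HarnessLib

/-!
# THE SEVEN PROFILE NUMBERS OF THE RECORD PROFILE AT RADIUS `r_B` ARE CONSTANTS ⇒ ★★★★ `exactDressing_of_recordProfile`: the exact dressing (`W̃`, `κ`, `ε_W = O(λ_b²)`) of the
# rate twin's hN/W package for lane A's cap-balanced stiff Gaussian profile `recordProfile L` supported in the fibre ball of radius `r_B = min (1/40) (β^{-1/2}·btLog β)`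
# (route `FlatTubeReduction`, crux K1 `NearFlatRatioLaw` stmt-QuantumFields-24720; seat `ym-line-ftr-p1` g17; rate twin «ratepack-v5»; R2b1 RECORD rung — no summit statement is proved here)

WHY (memo `Cruxes/NearFlatRatioLaw/Lines/ratepack-v5-nearpair-g16.md` §6 (P2)).  `…ExactDressingOfProfileNumbersSq.exactDressing_of_profileNumbers_sq` turns seven scalar facts about a
profile family (core mass `θ_β > 0`, total mass / `(√β‖x‖)^{3n}`-moment / `(1+β‖x‖²)⁴`-moment / mixed moment `≤ A·θ_β`, and the two fibre tails above `β‖x‖² > β^{1/8}` bounded by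
`t(β)θ_β`, `t ≤ A_t e^{−c_tβ^{1/8}}`) into the exact dressing of the (B-T)-rate brick.  For the record profile these are ratios of Gaussian moments in the anisotropic level
`N = balLevel β`: numerators `≤ (const)·v_β` by the transverse master bound `…GaussProfileNumbersII.orthoTransverse_gauss_moment_le` (weights `(√β‖x‖)^m, (1+β‖x‖²)^m ≤ (N+1)^m`,
profile `≤ e^{−c_L N}`), denominator `≥ k₀·v_β` by the core floor `…GaussProfileNumbersII.recordProfile_core_floor`; the `β`-dependent volume `v_β` cancels.  The tails carry the extra factor
`e^{−c_L β^{1/8}/2}` (`e^{−c_L N} ≤ e^{−c_Lβ^{1/8}/2}·e^{−(c_L/2)N}` above the level).  The window compatibility `β·E(r_B, 12L³δ₁⁴) ≤ 1` is `…RateBudgetR.eventually_beta_step_le_one_R`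
(monotonicity in the window constant covers `0 ≤ D_w < 1`).
* `window_compatible_recordRadius`, `eventually_recordRadius_le`, ★★★★ `exactDressing_of_recordProfile`.
HONEST FRAMING: bookkeeping on top of the two Gaussian-number files; the radius-`r_B` normaliser package and `profileDressing_package_R` are the NEXT files; femto rung R2b1 (RECORD label);
not infinite volume, not a gap, not Clay.  No defs, no named facts, no `sorry`.
-/

set_option autoImplicit false

noncomputable section

open MeasureTheory Filter Topology Real Set
open scoped BigOperators
open Literature.MathematicalPhysics.QuantumFieldTheory
open Literature.MathematicalPhysics.QuantumLattice

namespace Summit.QuantumFields.YangMills.Theorems.FemtoTransferGap.RateTube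

open Summit.QuantumFields.YangMills.Theorems.FemtoTransferGap
open Summit.QuantumFields.YangMills.Theorems.FemtoTransferGap.TwoLattice
open Summit.QuantumFields.YangMills.Theorems.FemtoTransferGap.TwoLattice.ConstTube
open Summit.QuantumFields.YangMills.Theorems.FemtoTransferGap.TwoLattice.Toron
open Summit.QuantumFields.YangMills.Theorems.FemtoTransferGap.TwoLattice.Avg
open Summit.QuantumFields.YangMills.Theorems.FemtoTransferGap.TwoLattice.Cov
open Summit.QuantumFields.YangMills.Theorems.FemtoTransferGap.TwoLattice.Stiff (LinkSpace)
open Summit.QuantumFields.YangMills.Theorems.FemtoCutoffLadder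

variable {L : ℕ} [NeZero L]

/-- ★ **Window compatibility at the record coordinate radius** `R_τ = btLog β·powScale (1/2) β`, for every window constant `D_w ≥ 0`:
`β·stepActionErr R_τ (L³·12(D_w·recordDelta1 L (1/6) β)⁴) ≤ 1` eventually (`…RateBudgetR.eventually_beta_step_le_one_R` at `max D_w 1` + monotonicity in the window). [folklore] -/
theorem window_compatible_recordRadius {Dw : ℝ} (hDw : 0 ≤ Dw) :
    ∀ᶠ β : ℝ in atTop, β * stepActionErr (L := L) (btLog β * powScale (1 / 2) β) ((L : ℝ) ^ 3 * (12 * (Dw * recordDelta1 L (1 / 6) β) ^ 4)) ≤ 1 := by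
  filter_upwards [eventually_beta_step_le_one_R (L := L) (le_max_right Dw 1), Filter.eventually_ge_atTop (0 : ℝ)] with β h hβ0
  refine le_trans (mul_le_mul_of_nonneg_left (stepActionErr_mono_right _ ?_) hβ0) h
  have hδ : 0 ≤ recordDelta1 L (1 / 6) β := by unfold recordDelta1; have := card_site_pos (L := L); have := powScale_pos (1 / 6) β; positivity
  have h1 : Dw * recordDelta1 L (1 / 6) β ≤ max Dw 1 * recordDelta1 L (1 / 6) β := mul_le_mul_of_nonneg_right (le_max_left _ _) hδ
  have h0 : 0 ≤ Dw * recordDelta1 L (1 / 6) β := mul_nonneg hDw hδ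
  have hL0 : (0 : ℝ) ≤ (L : ℝ) ^ 3 := by positivity
  exact mul_le_mul_of_nonneg_left (mul_le_mul_of_nonneg_left (pow_le_pow_left₀ h0 h1 4) (by norm_num)) hL0

/-- The record coordinate radius is eventually `≤ 1/30`. [folklore] -/
theorem eventually_recordRadius_le : ∀ᶠ β : ℝ in atTop, btLog β * powScale (1 / 2) β ≤ 1 / 30 := by
  filter_upwards [(tendsto_rf).eventually (eventually_le_nhds (by norm_num : (0 : ℝ) < 1 / 30))] with β h
  rw [mul_comm]; exact h

set_option maxHeartbeats 1600000 in
/-- ★★★★ **THE EXACT DRESSING OF THE RECORD PROFILE.**  `L ≥ 2`; window `δ₁ = D_w·recordDelta1 L (1/6)` (`D_w ≥ 0`); FP window `β⁻¹`; profile `Ω β = recordProfile L β` (lane A's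
cap-balanced stiff Gaussian profile at fibre radius `r_B = min (1/40) (powScale (1/2) β·btLog β)`), reference cores `coreBox L β`.  THEN `∃ κ ≥ 0, ε_W = O(λ_b(L³β)²)` such that
`W̃ β = clampW κ (f_β/f_β(1)) (min(d_tor,½))` (`f_β(u) = fpBOKernel(Ω β, fpWeight β⁻¹)(u,u)/K_{L³β}(u,u)`) is physical, `0 ≤ W̃ ≤ √(1+κ/4)`, `|W̃ β u² − 1| ≤ κ·orbitDist u²` on the window
(every `β`), and `|W̃ β u² − f_β u/f_β 1| ≤ ε_W β` on the window eventually — `exactDressing_of_profileNumbers_sq` fed with the seven Gaussian profile numbers. [cite: Luscher1983, §3] -/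
theorem exactDressing_of_recordProfile (hL : 2 ≤ L) {Dw : ℝ} (hDw : 0 ≤ Dw) :
    ∃ κ : ℝ, 0 ≤ κ ∧ ∃ εW : ℝ → ℝ, (∃ a' : ℝ, ∀ᶠ β : ℝ in atTop, εW β ≤ a' * bareLambda ((L : ℝ) ^ 3 * β) ^ 2) ∧ (∀ᶠ β : ℝ in atTop, 0 ≤ εW β) ∧
      (∀ β, IsPhys (clampW κ (fun u : GaugeConfig 3 1 SU2 => fpBOKernel L β (recordProfile L β) (fpWeight L β⁻¹) u u / transferKernel su2Rep ((L : ℝ) ^ 3 * β) u u /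
          (fpBOKernel L β (recordProfile L β) (fpWeight L β⁻¹) 1 1 / transferKernel su2Rep ((L : ℝ) ^ 3 * β) (1 : GaugeConfig 3 1 SU2) 1))
        (fun U : GaugeConfig 3 1 SU2 => min (torDist U) (1 / 2)))) ∧
      (∀ β u, 0 ≤ clampW κ (fun u : GaugeConfig 3 1 SU2 => fpBOKernel L β (recordProfile L β) (fpWeight L β⁻¹) u u / transferKernel su2Rep ((L : ℝ) ^ 3 * β) u u /
          (fpBOKernel L β (recordProfile L β) (fpWeight L β⁻¹) 1 1 / transferKernel su2Rep ((L : ℝ) ^ 3 * β) (1 : GaugeConfig 3 1 SU2) 1))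
        (fun U : GaugeConfig 3 1 SU2 => min (torDist U) (1 / 2)) u) ∧
      (∀ β u, |clampW κ (fun u : GaugeConfig 3 1 SU2 => fpBOKernel L β (recordProfile L β) (fpWeight L β⁻¹) u u / transferKernel su2Rep ((L : ℝ) ^ 3 * β) u u /
          (fpBOKernel L β (recordProfile L β) (fpWeight L β⁻¹) 1 1 / transferKernel su2Rep ((L : ℝ) ^ 3 * β) (1 : GaugeConfig 3 1 SU2) 1))
        (fun U : GaugeConfig 3 1 SU2 => min (torDist U) (1 / 2)) u| ≤ Real.sqrt (1 + κ / 4)) ∧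
      (∀ β u, orbitDist u < Dw * recordDelta1 L (1 / 6) β →
        |clampW κ (fun u : GaugeConfig 3 1 SU2 => fpBOKernel L β (recordProfile L β) (fpWeight L β⁻¹) u u / transferKernel su2Rep ((L : ℝ) ^ 3 * β) u u /
          (fpBOKernel L β (recordProfile L β) (fpWeight L β⁻¹) 1 1 / transferKernel su2Rep ((L : ℝ) ^ 3 * β) (1 : GaugeConfig 3 1 SU2) 1))
        (fun U : GaugeConfig 3 1 SU2 => min (torDist U) (1 / 2)) u ^ 2 - 1| ≤ κ * orbitDist u ^ 2) ∧
      (∀ᶠ β : ℝ in atTop, ∀ u : GaugeConfig 3 1 SU2, orbitDist u < Dw * recordDelta1 L (1 / 6) β →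
        |clampW κ (fun u : GaugeConfig 3 1 SU2 => fpBOKernel L β (recordProfile L β) (fpWeight L β⁻¹) u u / transferKernel su2Rep ((L : ℝ) ^ 3 * β) u u /
          (fpBOKernel L β (recordProfile L β) (fpWeight L β⁻¹) 1 1 / transferKernel su2Rep ((L : ℝ) ^ 3 * β) (1 : GaugeConfig 3 1 SU2) 1))
        (fun U : GaugeConfig 3 1 SU2 => min (torDist U) (1 / 2)) u ^ 2 -
          fpBOKernel L β (recordProfile L β) (fpWeight L β⁻¹) u u / transferKernel su2Rep ((L : ℝ) ^ 3 * β) u u /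
            (fpBOKernel L β (recordProfile L β) (fpWeight L β⁻¹) 1 1 / transferKernel su2Rep ((L : ℝ) ^ 3 * β) (1 : GaugeConfig 3 1 SU2) 1)| ≤ εW β) := by
  have hle := measurable_linkEmbed L
  obtain ⟨hΩm, hΩ01, hΩabs, hΩinv⟩ := recordProfile_fields L
  -- the two Gaussian-number machines
  obtain ⟨K, β₁, hK, hβ₁1, hmom⟩ := orthoTransverse_gauss_moment_le L
  obtain ⟨k₀, β₂, hk₀, hβ₂, hfloor⟩ := recordProfile_core_floor L
  -- the constants
  obtain ⟨c, hcdef⟩ : ∃ c : ℝ, c = min 1 ((2 - 2 * Real.cos (2 * Real.pi / L)) / 2) := ⟨_, rfl⟩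
  have hc0 : 0 < c := by rw [hcdef]; exact lt_min one_pos (half_pos (gap_pos (L := L) hL))
  have hc1 : c ≤ 1 := by rw [hcdef]; exact min_le_left _ _
  have hc20 : 0 < c / 2 := half_pos hc0
  have hc21 : c / 2 ≤ 1 := by linarith
  set n : ℕ := Fintype.card {x : Site 3 L // ¬x = 0} with hn
  set d : ℕ := Module.finrank ℝ ({e : Edge 3 L // ¬e.1 = 0} → Fin 3 → ℝ) with hd
  obtain ⟨Kk, hKk⟩ : ∃ Kk : ℝ → ℕ → ℝ, Kk = fun a k => K * (5 * Real.exp 1 * 2 ^ k * 4 ^ d * k.factorial * d.factorial) * (a ^ (k + d))⁻¹ := ⟨_, rfl⟩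
  have hKk0 : ∀ {a : ℝ}, 0 < a → ∀ k, 0 ≤ Kk a k := fun {a} ha k => by rw [hKk]; positivity
  obtain ⟨θ, hθdef⟩ : ∃ θ : ℝ → ℝ, θ = fun β => ∫ v in coreBox L β, recordProfile L β (linkEmbed L v) ∂orthoTransverse L := ⟨_, rfl⟩
  obtain ⟨vb, hvbdef⟩ : ∃ vb : ℝ → ℝ, vb = fun β => (volume {w : {e : Edge 3 L // ¬e.1 = 0} → Fin 3 → ℝ | balLevel L β (balExt L w) ≤ 1}).toReal := ⟨_, rfl⟩
  set A : ℝ := (Kk c 0 + Kk c (3 * n) + Kk c 4 + Kk c (4 + 3 * n)) / k₀ with hA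
  set At : ℝ := (Kk (c / 2) 0 + Kk (c / 2) (3 * n)) / k₀ with hAt
  obtain ⟨t, htdef⟩ : ∃ t : ℝ → ℝ, t = fun β => At * Real.exp (-(c / 2 * β ^ ((1 : ℝ) / 8))) := ⟨_, rfl⟩
  have hA0 : 0 ≤ A := by rw [hA]; exact div_nonneg (by have := hKk0 hc0 0; have := hKk0 hc0 (3 * n); have := hKk0 hc0 4; have := hKk0 hc0 (4 + 3 * n); linarith) hk₀.le
  have hAt0 : 0 ≤ At := by rw [hAt]; exact div_nonneg (by have := hKk0 hc20 0; have := hKk0 hc20 (3 * n); linarith) hk₀.le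
  -- pointwise facts about the profile
  have hup : ∀ {β : ℝ}, 1 ≤ β → ∀ v : Edge 3 L → Fin 3 → ℝ, recordProfile L β (linkEmbed L v) ≤ Real.exp (-(c * balLevel L β v)) := fun hβ v => by
    rw [hcdef]; exact recordProfile_le_exp_neg L hL hβ v
  have hsupp : ∀ β (v : Edge 3 L → Fin 3 → ℝ), recordProfile L β (linkEmbed L v) ≠ 0 → ‖linkEmbed L v‖ ≤ min (1 / 40) (powScale (1 / 2) β * btLog β) := fun β v hv =>
    (recordProfile_support L hv).2.2
  -- ★ the master step: numerator ≤ (D·Kk a k / k₀)·θ β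
  have key : ∀ β, max β₁ β₂ ≤ β → ∀ a : ℝ, 0 < a → a ≤ 1 → ∀ (k : ℕ) (D : ℝ), 0 ≤ D → ∀ f : (Edge 3 L → Fin 3 → ℝ) → ℝ, Measurable f → (∀ v, 0 ≤ f v) →
      (∀ v, f v ≤ D * (Real.exp (-(a * balLevel L β v)) * (balLevel L β v + 1) ^ k)) →
      (∀ v, f v ≠ 0 → ‖linkEmbed L v‖ ≤ min (1 / 40) (powScale (1 / 2) β * btLog β)) →
      ∫ v, f v ∂orthoTransverse L ≤ D * Kk a k / k₀ * θ β := by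
    intro β hβ a ha0 ha1 k D hD f hf hf0 hfle hfs
    have h1 := hmom β ((le_max_left _ _).trans hβ) a ha0 ha1 k D hD f hf hf0 hfle hfs
    have h2 := hfloor β ((le_max_right _ _).trans hβ)
    have h3 : ∫ v, f v ∂orthoTransverse L ≤ D * Kk a k * vb β := by rw [hKk, hvbdef]; convert h1 using 1; ring
    have h4 : vb β ≤ θ β / k₀ := by rw [le_div_iff₀ hk₀, hθdef, hvbdef, mul_comm]; exact h2
    calc ∫ v, f v ∂orthoTransverse L ≤ D * Kk a k * vb β := h3
      _ ≤ D * Kk a k * (θ β / k₀) := mul_le_mul_of_nonneg_left h4 (mul_nonneg hD (hKk0 ha0 k))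
      _ = D * Kk a k / k₀ * θ β := by ring
  have hθ0 : ∀ β, max β₁ β₂ ≤ β → 0 < θ β := fun β hβ => by
    have h2 := hfloor β ((le_max_right _ _).trans hβ)
    have hβ1 : 1 ≤ β := hβ₁1.trans ((le_max_left _ _).trans hβ)
    rw [hθdef]; exact lt_of_lt_of_le (mul_pos hk₀ (volume_real_sublevel_one_pos L hβ1)) h2
  have hev := Filter.eventually_ge_atTop (max β₁ β₂)
  -- measurability of the weights
  have hmM : ∀ β : ℝ, Measurable fun v : Edge 3 L → Fin 3 → ℝ => (Real.sqrt β * ‖linkEmbed L v‖) ^ (3 * n) := fun β => (measurable_const.mul hle.norm).pow_const _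
  have hm4 : ∀ β : ℝ, Measurable fun v : Edge 3 L → Fin 3 → ℝ => (1 + β * ‖linkEmbed L v‖ ^ 2) ^ 4 := fun β =>
    (measurable_const.add ((hle.norm.pow_const 2).const_mul β)).pow_const 4
  have hmΩ : ∀ β, Measurable fun v : Edge 3 L → Fin 3 → ℝ => recordProfile L β (linkEmbed L v) := fun β => (hΩm β).comp hle
  -- (1) total mass
  have hI : ∀ᶠ β : ℝ in atTop, ∫ v, recordProfile L β (linkEmbed L v) ∂orthoTransverse L ≤ A * ∫ v in coreBox L β, recordProfile L β (linkEmbed L v) ∂orthoTransverse L := by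
    filter_upwards [hev] with β hβ
    have hβ1 : 1 ≤ β := hβ₁1.trans ((le_max_left _ _).trans hβ)
    have h := key β hβ c hc0 hc1 0 1 zero_le_one _ (hmΩ β) (fun v => (hΩ01 β _).1) (fun v => by rw [pow_zero, mul_one, one_mul]; exact hup hβ1 v) (hsupp β)
    have hθ := hθ0 β hβ
    rw [hθdef] at h hθ
    refine h.trans (mul_le_mul_of_nonneg_right ?_ hθ.le)
    rw [hA, one_mul, div_le_div_iff_of_pos_right hk₀]
    linarith [hKk0 hc0 (3 * n), hKk0 hc0 4, hKk0 hc0 (4 + 3 * n)]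
  -- (2) the `(√β‖x‖)^{3n}` moment
  have hM : ∀ᶠ β : ℝ in atTop, ∫ v, recordProfile L β (linkEmbed L v) * (Real.sqrt β * ‖linkEmbed L v‖) ^ (3 * n) ∂orthoTransverse L ≤
      A * ∫ v in coreBox L β, recordProfile L β (linkEmbed L v) ∂orthoTransverse L := by
    filter_upwards [hev] with β hβ
    have hβ1 : 1 ≤ β := hβ₁1.trans ((le_max_left _ _).trans hβ)
    have h := key β hβ c hc0 hc1 (3 * n) 1 zero_le_one _ ((hmΩ β).mul (hmM β)) (fun v => mul_nonneg (hΩ01 β _).1 (by positivity))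
      (fun v => by rw [one_mul]; exact mul_le_mul (hup hβ1 v) (sqrt_mul_norm_pow_le_balLevel_add_one L hβ1 v _) (by positivity) (Real.exp_pos _).le)
      (fun v hv => hsupp β v (left_ne_zero_of_mul hv))
    have hθ := hθ0 β hβ
    rw [hθdef] at h hθ
    refine h.trans (mul_le_mul_of_nonneg_right ?_ hθ.le)
    rw [hA, one_mul, div_le_div_iff_of_pos_right hk₀]
    linarith [hKk0 hc0 0, hKk0 hc0 4, hKk0 hc0 (4 + 3 * n)]
  -- (3) the `(1+β‖x‖²)⁴` moment
  have hI4 : ∀ᶠ β : ℝ in atTop, ∫ v, recordProfile L β (linkEmbed L v) * (1 + β * ‖linkEmbed L v‖ ^ 2) ^ 4 ∂orthoTransverse L ≤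
      A * ∫ v in coreBox L β, recordProfile L β (linkEmbed L v) ∂orthoTransverse L := by
    filter_upwards [hev] with β hβ
    have hβ1 : 1 ≤ β := hβ₁1.trans ((le_max_left _ _).trans hβ)
    have h := key β hβ c hc0 hc1 4 1 zero_le_one _ ((hmΩ β).mul (hm4 β)) (fun v => mul_nonneg (hΩ01 β _).1 (by positivity))
      (fun v => by rw [one_mul]; exact mul_le_mul (hup hβ1 v) (one_add_mul_norm_sq_pow_le L hβ1 v 4) (by positivity) (Real.exp_pos _).le)
      (fun v hv => hsupp β v (left_ne_zero_of_mul hv))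
    have hθ := hθ0 β hβ
    rw [hθdef] at h hθ
    refine h.trans (mul_le_mul_of_nonneg_right ?_ hθ.le)
    rw [hA, one_mul, div_le_div_iff_of_pos_right hk₀]
    linarith [hKk0 hc0 0, hKk0 hc0 (3 * n), hKk0 hc0 (4 + 3 * n)]
  -- (4) the mixed moment
  have hM4 : ∀ᶠ β : ℝ in atTop, ∫ v, recordProfile L β (linkEmbed L v) * (1 + β * ‖linkEmbed L v‖ ^ 2) ^ 4 * (Real.sqrt β * ‖linkEmbed L v‖) ^ (3 * n) ∂orthoTransverse L ≤
      A * ∫ v in coreBox L β, recordProfile L β (linkEmbed L v) ∂orthoTransverse L := by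
    filter_upwards [hev] with β hβ
    have hβ1 : 1 ≤ β := hβ₁1.trans ((le_max_left _ _).trans hβ)
    have h := key β hβ c hc0 hc1 (4 + 3 * n) 1 zero_le_one _ (((hmΩ β).mul (hm4 β)).mul (hmM β))
      (fun v => mul_nonneg (mul_nonneg (hΩ01 β _).1 (by positivity)) (by positivity))
      (fun v => by
        rw [one_mul, pow_add, ← mul_assoc]
        exact mul_le_mul (mul_le_mul (hup hβ1 v) (one_add_mul_norm_sq_pow_le L hβ1 v 4) (by positivity) (Real.exp_pos _).le)
          (sqrt_mul_norm_pow_le_balLevel_add_one L hβ1 v _) (by positivity) (mul_nonneg (Real.exp_pos _).le (by positivity)))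
      (fun v hv => hsupp β v (left_ne_zero_of_mul (left_ne_zero_of_mul hv)))
    have hθ := hθ0 β hβ
    rw [hθdef] at h hθ
    refine h.trans (mul_le_mul_of_nonneg_right ?_ hθ.le)
    rw [hA, one_mul, div_le_div_iff_of_pos_right hk₀]
    linarith [hKk0 hc0 0, hKk0 hc0 (3 * n), hKk0 hc0 4]
  -- (5)/(6) the tails above `β‖x‖² > β^{1/8}`
  have hSm : ∀ β : ℝ, MeasurableSet {v : Edge 3 L → Fin 3 → ℝ | β ^ ((1 : ℝ) / 8) < β * ‖linkEmbed L v‖ ^ 2} := fun β =>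
    measurableSet_lt measurable_const ((hle.norm.pow_const 2).const_mul β)
  have htailpt : ∀ {β : ℝ}, 1 ≤ β → ∀ v : Edge 3 L → Fin 3 → ℝ, β ^ ((1 : ℝ) / 8) < β * ‖linkEmbed L v‖ ^ 2 →
      recordProfile L β (linkEmbed L v) ≤ Real.exp (-(c / 2 * β ^ ((1 : ℝ) / 8))) * Real.exp (-(c / 2 * balLevel L β v)) := fun {β} hβ1 v hv => by
    refine (hup hβ1 v).trans ?_
    rw [← Real.exp_add]
    refine Real.exp_le_exp.2 ?_
    have hN := mul_norm_sq_le_balLevel L hβ1 v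
    nlinarith
  have htail : ∀ β, max β₁ β₂ ≤ β → ∀ (k : ℕ) (M : (Edge 3 L → Fin 3 → ℝ) → ℝ), Measurable M → (∀ v, 0 ≤ M v) → (∀ v, M v ≤ (balLevel L β v + 1) ^ k) →
      ∫ v in {v | β ^ ((1 : ℝ) / 8) < β * ‖linkEmbed L v‖ ^ 2}, recordProfile L β (linkEmbed L v) * M v ∂orthoTransverse L ≤ Kk (c / 2) k / k₀ * Real.exp (-(c / 2 * β ^ ((1 : ℝ) / 8))) * θ β := by
    intro β hβ k M hMm hM0 hMle
    have hβ1 : 1 ≤ β := hβ₁1.trans ((le_max_left _ _).trans hβ)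
    rw [← integral_indicator (hSm β)]
    have h := key β hβ (c / 2) hc20 hc21 k (Real.exp (-(c / 2 * β ^ ((1 : ℝ) / 8)))) (Real.exp_pos _).le
      ({v : Edge 3 L → Fin 3 → ℝ | β ^ ((1 : ℝ) / 8) < β * ‖linkEmbed L v‖ ^ 2}.indicator fun v => recordProfile L β (linkEmbed L v) * M v)
      (((hmΩ β).mul hMm).indicator (hSm β)) (fun v => Set.indicator_nonneg (fun v _ => mul_nonneg (hΩ01 β _).1 (hM0 v)) v) (fun v => by
        have hN0 : 0 ≤ balLevel L β v := balLevel_nonneg L (by linarith) v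
        by_cases hv : v ∈ {v : Edge 3 L → Fin 3 → ℝ | β ^ ((1 : ℝ) / 8) < β * ‖linkEmbed L v‖ ^ 2}
        · rw [Set.indicator_of_mem hv]
          calc recordProfile L β (linkEmbed L v) * M v ≤ Real.exp (-(c / 2 * β ^ ((1 : ℝ) / 8))) * Real.exp (-(c / 2 * balLevel L β v)) * (balLevel L β v + 1) ^ k :=
                mul_le_mul (htailpt hβ1 v hv) (hMle v) (hM0 v) (mul_nonneg (Real.exp_pos _).le (Real.exp_pos _).le)
            _ = _ := mul_assoc _ _ _
        · rw [Set.indicator_of_notMem hv]; exact mul_nonneg (Real.exp_pos _).le (mul_nonneg (Real.exp_pos _).le (pow_nonneg (by linarith) _)))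
      (fun v hv => by
        have hv' : recordProfile L β (linkEmbed L v) * M v ≠ 0 := fun h0 => hv (by
          by_cases hm : v ∈ {v : Edge 3 L → Fin 3 → ℝ | β ^ ((1 : ℝ) / 8) < β * ‖linkEmbed L v‖ ^ 2}
          · rw [Set.indicator_of_mem hm]; exact h0
          · exact Set.indicator_of_notMem hm _)
        exact hsupp β v (left_ne_zero_of_mul hv'))
    refine h.trans (le_of_eq ?_); ring
  have htail0 : ∀ᶠ β : ℝ in atTop, ∫ v in {v | β ^ ((1 : ℝ) / 8) < β * ‖linkEmbed L v‖ ^ 2}, recordProfile L β (linkEmbed L v) ∂orthoTransverse L ≤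
      t β * ∫ v in coreBox L β, recordProfile L β (linkEmbed L v) ∂orthoTransverse L := by
    filter_upwards [hev] with β hβ
    have h := htail β hβ 0 (fun _ => 1) measurable_const (fun _ => zero_le_one) (fun v => by rw [pow_zero])
    have hθ := hθ0 β hβ
    simp only [mul_one] at h
    rw [hθdef] at h hθ
    refine h.trans (mul_le_mul_of_nonneg_right ?_ hθ.le)
    rw [htdef, hAt]
    refine mul_le_mul_of_nonneg_right ?_ (Real.exp_pos _).le
    rw [div_le_div_iff_of_pos_right hk₀]; linarith [hKk0 hc20 (3 * n)]
  have htail3 : ∀ᶠ β : ℝ in atTop, ∫ v in {v | β ^ ((1 : ℝ) / 8) < β * ‖linkEmbed L v‖ ^ 2}, recordProfile L β (linkEmbed L v) * (Real.sqrt β * ‖linkEmbed L v‖) ^ (3 * n) ∂orthoTransverse L ≤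
      t β * ∫ v in coreBox L β, recordProfile L β (linkEmbed L v) ∂orthoTransverse L := by
    filter_upwards [hev] with β hβ
    have hβ1 : 1 ≤ β := hβ₁1.trans ((le_max_left _ _).trans hβ)
    have h := htail β hβ (3 * n) _ (hmM β) (fun v => by positivity) (fun v => sqrt_mul_norm_pow_le_balLevel_add_one L hβ1 v _)
    have hθ := hθ0 β hβ
    rw [hθdef] at h hθ
    refine h.trans (mul_le_mul_of_nonneg_right ?_ hθ.le)
    rw [htdef, hAt]
    refine mul_le_mul_of_nonneg_right ?_ (Real.exp_pos _).le
    rw [div_le_div_iff_of_pos_right hk₀]; linarith [hKk0 hc20 0]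
  -- (7) the core mass is positive
  have hθ : ∀ᶠ β : ℝ in atTop, 0 < ∫ v in coreBox L β, recordProfile L β (linkEmbed L v) ∂orthoTransverse L := by
    filter_upwards [hev] with β hβ; have h := hθ0 β hβ; rwa [hθdef] at h
  -- the structural hypotheses and the assembly
  have ht0 : ∀ᶠ β : ℝ in atTop, 0 ≤ t β := Filter.Eventually.of_forall fun β => by rw [htdef]; exact mul_nonneg hAt0 (Real.exp_pos _).le
  have htdecay : ∀ᶠ β : ℝ in atTop, t β ≤ At * Real.exp (-(c / 2 * β ^ ((1 : ℝ) / 8))) := Filter.Eventually.of_forall fun β => by rw [htdef]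
  exact exactDressing_of_profileNumbers_sq (L := L) (A := A) (At := At) (ct := c / 2) hDw hA0 hAt0 hc20 (recordProfile L) (fun _ => 1)
    (fun β => min (1 / 40) (powScale (1 / 2) β * btLog β)) (fun β => btLog β * powScale (1 / 2) β) t (coreBox L) hΩm hΩabs (fun β x => (hΩ01 β x).1) hΩinv
    (fun β v hv => ⟨(recordProfile_support L hv).1, (recordProfile_support L hv).2.2⟩) eventually_recordRadius_le
    (fun β v hv e c' => ((recordProfile_support L hv).2.1 e c').trans ((min_le_right _ _).trans (le_of_eq (mul_comm _ _))))
    (window_compatible_recordRadius (L := L) hDw) (measurableSet_coreBox L) (fun β v hv => hv) hθ hI hM hI4 hM4 ht0 htail0 htail3 htdecay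

end Summit.QuantumFields.YangMills.Theorems.FemtoTransferGap.RateTube

end
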